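import Literature.Computability.AlgebraicComplexity.FlipGraphCyclicGroupAction
import Literature.Computability.AlgebraicComplexity.FlipGraphStandardFlips
import HarnessLib

/-!
# The `C₃`-invariant starting point of a diagonal partition (Moosbauer–Poole 2025, Def. 6 / Lemma 7)

Topic `Literature/Computability/AlgebraicComplexity`; companion of `FlipGraphCyclicSymmetry.lean`
(the group `C₃` of `⟨n,n,n⟩`, `cycRep`, `IsInvariantUnder`, `orbitFinset`; its §3 is the instance
`n = 3`, `𝒫 = {{1,2},{3}}` over `ℤ₂` by kernel evaluation) and `FlipGraphStandardFlips.lean` (the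
standard products `StdFlips.E`). Source: J. Moosbauer, M. Poole, *Flip Graphs with Symmetry and
New Matrix Multiplication Schemes*, ISSAC 2025 = arXiv:2502.04514 (MP), §4:

* **Def. 6** (`G = C₃`): "Let `𝒫` be a partition of `{1,…,n}` … Let
  `T = {(Σ_{i∈P} a_{ii}) ⊗ (Σ_{i∈P} b_{ii}) ⊗ (Σ_{i∈P} c_{ii}) | P ∈ 𝒫}`. Let `S` be the decomposition
  of `M_n − Σ_{t∈T} t` into standard basis elements. Then we call `S ∪ T` the starting point for
  the diagonal partition `𝒫`."
* **Lemma 7** (`G = C₃`): "`S ∪ T` is a `G`-invariant matrix multiplication scheme and the orbit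
  of every element in `S` has size `|G|`." Proof as printed: `T` is invariant by construction;
  `S` consists of the `a_{ij}⊗b_{jk}⊗c_{ki}` and the correction terms `a_{ii}⊗b_{jj}⊗c_{kk}`, in
  both kinds not `i = j = k`, and the generator `g·a_{ij}⊗b_{jk}⊗c_{ki} = a_{jk}⊗b_{ki}⊗c_{ij}`
  fixes such an element only if `i = j = k`.

Here for EVERY `n`, every field `K` and every partition, the partition being given as a block
labelling `col : Fin n → β` onto a finite type `β` (block `P_b = col⁻¹(b)`; `col` surjective so
that no block is empty). In the tree's slots `(Z, X, Y)` (`⟨n,n,n⟩ = Σ e_{κν}⊗e_{κμ}⊗e_{μν}`,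
MP's `a_{ij}⊗b_{jk}⊗c_{ki}` with `C` read transposed) the elements are: the standard products
`E_{κμν}`, `(κ,μ,ν)` not constant; the correction terms `−e_{kk}⊗e_{ii}⊗e_{jj}`, `i,j,k` in one
block and not all equal (over a general field the decomposition of `M_n − ΣT` into standard basis
elements carries the sign `−1`; over `ℤ₂`, MP's setting, `−1 = 1`); and the cubes
`T_b = D_b⊗D_b⊗D_b`, `D_b = Σ_{i∈P_b} e_{ii}`. The rank is `(n³ − n) + (Σ_b |P_b|³ − n) + |𝒫|`
(`rank_start_eq`; MP: "schemes of rank `k·|G| + |𝒫|`"). §5 treats `G = C₃ × ℤ₂`: MP's generator `g` (cyclic shift followed by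
conjugation with the reversal permutation matrix, `DiagonalStart.gSym`), invariance of the
starting point of a reversal-compatible partition under `g` (`start_map_gSym`,
`start_invariant_gSym`), and six pairwise distinct images `g^k s` for every `s ∈ S`
(`injective_pow_E`, `injective_pow_corr`; `moosbauerPoole2025_lemma7_C3Z2`); §6 the invariant
standard products (MP §4: `C₃`-invariant iff `i = j = k`, `cycleMap_E_eq_iff`; `ℤ₂`-invariant:
none for even `n`, exactly the middle cube for odd `n`, `no_rev_invariant_E_of_even`,
`rev_invariant_E_iff_of_odd`). §7–§8: `g⁶ = id` on the whole tensor space (`gSym_iterate_six`, via the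
rank-one decomposition of every tensor), hence `k ↦ g^k` is an action of the cyclic group of
order `6` by symmetries (`FlipGraphCyclicGroupAction.lean`) and MP Lemma 7 (ii) becomes the orbit
count `|G·s| = 6` of `FlipGraphOrbitFlips.lean` (`card_orbitFinset_gSym_E/_corr`,
`moosbauerPoole2025_lemma7_C3Z2_orbits`).
Everything is PROVED (the sum by multilinear
expansion of the cubes, the invariance and the orbit sizes from `ρ(E_{κμν}) = E_{μνκ}`); no
named facts.

## References

* J. Moosbauer, M. Poole, *Flip Graphs with Symmetry and New Matrix Multiplication Schemes*,
  ISSAC 2025, doi:10.1145/3747199.3747566, arXiv:2502.04514: §4 Def. 6, Lemma 7 (with §2, Def. 2,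
  Thm. 4). [MoosbauerPoole2025]
* M. Kauers, J. Moosbauer, *Flip Graphs for Matrix Multiplication*, ISSAC 2023, arXiv:2212.01175:
  Def. 1 (schemes), §2 (the cyclic shift). [KauersMoosbauer2022FlipGraphs]
-/

namespace Literature.Computability.AlgebraicComplexity

open scoped BigOperators
open Multiset

namespace DiagonalStart

open FlipGraph StdFlips

variable (K : Type*) [Field K] {n : ℕ} {β : Type*} [Fintype β] [DecidableEq β]

/-! ## §1 The elements of the starting point -/

/-- The matrix unit `e_p`. [cite: MoosbauerPoole2025, §4 (standard basis elements)] -/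
def unit (p : Fin n × Fin n) : Fin n × Fin n → K := Pi.single p 1

/-- The mixed diagonal product `e_{kk} ⊗ e_{ii} ⊗ e_{jj}` (tree slots `(Z,X,Y)`; MP's correction term
`a_{ii}⊗b_{jj}⊗c_{kk}`) indexed by `s = (k,i,j)`. [cite: MoosbauerPoole2025, Def. 6, Lemma 7 (proof)] -/
def corr (s : Idx n) : (Fin n × Fin n) → (Fin n × Fin n) → (Fin n × Fin n) → K :=
  triad (unit K (s.1, s.1)) (unit K (s.2.1, s.2.1)) (unit K (s.2.2, s.2.2))

/-- The block diagonal `D_b = Σ_{i ∈ P_b} e_{ii}` of block `b`. [cite: MoosbauerPoole2025, Def. 6] -/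
def blockDiag (col : Fin n → β) (b : β) : Fin n × Fin n → K :=
  fun q => if q.1 = q.2 ∧ col q.1 = b then 1 else 0

/-- The cube `T_b = D_b ⊗ D_b ⊗ D_b` of block `b` (MP: `(Σ_{i∈P} a_{ii})⊗(Σ_{i∈P} b_{ii})⊗(Σ_{i∈P} c_{ii})`).
[cite: MoosbauerPoole2025, Def. 6 (the set `T`)] -/
def cube (col : Fin n → β) (b : β) : (Fin n × Fin n) → (Fin n × Fin n) → (Fin n × Fin n) → K :=
  triad (blockDiag K col b) (blockDiag K col b) (blockDiag K col b)

variable {K}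

/-- The non-constant index triples (MP: "we cannot have `i = j = k`"). [cite: MoosbauerPoole2025, Lemma 7 (proof)] -/
def ndIdx (n : ℕ) : Finset (Idx n) :=
  Finset.univ.filter fun s => ¬ (s.1 = s.2.1 ∧ s.2.1 = s.2.2)

/-- The block of block `b`: `P_b = col⁻¹(b)`. [cite: MoosbauerPoole2025, Def. 6] -/
def block (col : Fin n → β) (b : β) : Finset (Fin n) := Finset.univ.filter fun i => col i = b

/-- The monochromatic index triples (all three indices in one block). [cite: MoosbauerPoole2025, Def. 6] -/
def monoIdx (col : Fin n → β) : Finset (Idx n) :=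
  Finset.univ.filter fun s => col s.2.1 = col s.1 ∧ col s.2.2 = col s.1

/-- The monochromatic non-constant index triples: the correction terms of `S`.
[cite: MoosbauerPoole2025, Def. 6, Lemma 7 (proof)] -/
def corrIdx (col : Fin n → β) : Finset (Idx n) :=
  Finset.univ.filter fun s => (col s.2.1 = col s.1 ∧ col s.2.2 = col s.1) ∧ ¬ (s.1 = s.2.1 ∧ s.2.1 = s.2.2)

variable (K)

/-- **The elements of the starting point `S ∪ T`** of the diagonal partition `col`: `S` = the
standard products `E_s`, `s` not constant, and the correction terms `−e_{kk}⊗e_{ii}⊗e_{jj}`,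
`(k,i,j)` monochromatic and not constant; `T` = the cubes `T_b`. [cite: MoosbauerPoole2025, Def. 6] -/
def startElts (col : Fin n → β) :
    Multiset ((Fin n × Fin n) → (Fin n × Fin n) → (Fin n × Fin n) → K) :=
  (ndIdx n).val.map (E K n) + (corrIdx col).val.map (fun s => -corr K s) +
    (Finset.univ : Finset β).val.map (cube K col)

/-! ## §2 `Σ S + Σ T = M_n` -/

variable {K}

/-- `⟨n,n,n⟩ = Σ_s E_s`. [cite: KauersMoosbauer2022FlipGraphs, §2 (the standard algorithm)] -/
theorem matMulTensor_eq_sum_E : matMulTensor K n n n = ∑ s : Idx n, E K n s := by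
  rw [← (stdScheme (matMulTensor K n n n)).sum_eq, stdScheme_elts, sum_fam]
  rfl

/-- A constant triple is `(i,i,i)`. [folklore] -/
private theorem filter_const_eq_image :
    (Finset.univ.filter fun s : Idx n => s.1 = s.2.1 ∧ s.2.1 = s.2.2) =
      Finset.univ.image fun i : Fin n => ((i, i, i) : Idx n) := by
  ext s
  simp only [Finset.mem_filter, Finset.mem_univ, true_and, Finset.mem_image]
  constructor
  · rintro ⟨h1, h2⟩
    exact ⟨s.1, Prod.ext rfl (Prod.ext h1 (h1.trans h2))⟩
  · rintro ⟨i, rfl⟩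
    exact ⟨rfl, rfl⟩

/-- `Σ_s E_s = Σ_{s not constant} E_s + Σ_i E_{iii}`. [cite: MoosbauerPoole2025, Def. 6] -/
theorem sum_E_split :
    ∑ s : Idx n, E K n s = ∑ s ∈ ndIdx n, E K n s + ∑ i : Fin n, E K n (i, i, i) := by
  have h := Finset.sum_filter_add_sum_filter_not (Finset.univ : Finset (Idx n))
    (fun s : Idx n => s.1 = s.2.1 ∧ s.2.1 = s.2.2) (E K n)
  rw [filter_const_eq_image, Finset.sum_image (fun i _ j _ h => (Prod.mk.inj h).1)] at h
  rw [← h, add_comm]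
  rfl

omit [Fintype β] in
/-- The block diagonal is the sum of the diagonal units of its block. [cite: MoosbauerPoole2025, Def. 6] -/
theorem blockDiag_eq_sum (col : Fin n → β) (b : β) :
    blockDiag K col b = ∑ i ∈ block col b, unit K (i, i) := by
  funext q
  obtain ⟨q1, q2⟩ := q
  simp only [blockDiag, unit, Finset.sum_apply, Pi.single_apply, Prod.mk.injEq, block]
  by_cases h : q1 = q2
  · subst h
    simp only [true_and, and_self]
    rw [Finset.sum_ite_eq]
    simp only [Finset.mem_filter, Finset.mem_univ, true_and]
  · rw [if_neg (fun hh => h hh.1)]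
    refine (Finset.sum_eq_zero fun i _ => ?_).symm
    rw [if_neg]
    rintro ⟨rfl, rfl⟩
    exact h rfl

/-- Multilinearity of `⊗` in the first slot over a finite sum. [folklore] -/
private theorem triad_sum₁ {α : Type*} (s : Finset α) (f : α → Fin n × Fin n → K)
    (b c : Fin n × Fin n → K) : triad (∑ i ∈ s, f i) b c = ∑ i ∈ s, triad (f i) b c := by
  funext x y z
  simp only [triad_apply, Finset.sum_apply, Finset.sum_mul]

/-- Multilinearity of `⊗` in the second slot over a finite sum. [folklore] -/
private theorem triad_sum₂ {α : Type*} (s : Finset α) (a : Fin n × Fin n → K)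
    (f : α → Fin n × Fin n → K) (c : Fin n × Fin n → K) :
    triad a (∑ i ∈ s, f i) c = ∑ i ∈ s, triad a (f i) c := by
  funext x y z
  simp only [triad_apply, Finset.sum_apply, Finset.mul_sum, Finset.sum_mul]

/-- Multilinearity of `⊗` in the third slot over a finite sum. [folklore] -/
private theorem triad_sum₃ {α : Type*} (s : Finset α) (a b : Fin n × Fin n → K)
    (f : α → Fin n × Fin n → K) : triad a b (∑ i ∈ s, f i) = ∑ i ∈ s, triad a b (f i) := by
  funext x y z
  simp only [triad_apply, Finset.sum_apply, Finset.mul_sum]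

omit [Fintype β] in
/-- **Expansion of the cube:** `T_b = Σ_{k,i,j ∈ P_b} e_{kk}⊗e_{ii}⊗e_{jj}`. [cite: MoosbauerPoole2025, Lemma 7 (proof: "correction terms for `T` … of the form `a_{ii}⊗b_{jj}⊗c_{kk}`")] -/
theorem cube_eq_sum (col : Fin n → β) (b : β) :
    cube K col b = ∑ s ∈ block col b ×ˢ (block col b ×ˢ block col b), corr K s := by
  rw [cube, blockDiag_eq_sum, triad_sum₁, Finset.sum_product]
  refine Finset.sum_congr rfl fun k _ => ?_
  rw [triad_sum₂, Finset.sum_product]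
  refine Finset.sum_congr rfl fun i _ => ?_
  rw [triad_sum₃]
  rfl

omit [Fintype β] in
/-- The monochromatic triples with first index in block `b` are `P_b³`. [folklore] -/
private theorem monoIdx_filter (col : Fin n → β) (b : β) :
    (monoIdx col).filter (fun s => col s.1 = b) = block col b ×ˢ (block col b ×ˢ block col b) := by
  ext s
  simp only [monoIdx, block, Finset.mem_filter, Finset.mem_univ, true_and, Finset.mem_product]
  constructor
  · rintro ⟨⟨h1, h2⟩, h3⟩
    exact ⟨h3, h1.trans h3, h2.trans h3⟩
  · rintro ⟨h1, h2, h3⟩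
    exact ⟨⟨h2.trans h1.symm, h3.trans h1.symm⟩, h1⟩

/-- **`Σ_b T_b = Σ_{s monochromatic} e⊗e⊗e`.** [cite: MoosbauerPoole2025, Lemma 7 (proof)] -/
theorem sum_cube (col : Fin n → β) : ∑ b, cube K col b = ∑ s ∈ monoIdx col, corr K s := by
  rw [← Finset.sum_fiberwise (monoIdx col) (fun s => col s.1) (corr K)]
  exact Finset.sum_congr rfl fun b _ => by rw [cube_eq_sum, monoIdx_filter]

omit [Fintype β] in
/-- `Σ_{monochromatic} = Σ_{correction terms} + Σ_i e_{ii}^{⊗3}`. [cite: MoosbauerPoole2025, Def. 6] -/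
theorem sum_monoIdx (col : Fin n → β) :
    ∑ s ∈ monoIdx col, corr K s = ∑ s ∈ corrIdx col, corr K s + ∑ i : Fin n, E K n (i, i, i) := by
  rw [← Finset.sum_filter_add_sum_filter_not (monoIdx col)
    (fun s : Idx n => s.1 = s.2.1 ∧ s.2.1 = s.2.2), add_comm]
  congr 1
  · rw [corrIdx, monoIdx, Finset.filter_filter]
  · have e : (monoIdx col).filter (fun s : Idx n => s.1 = s.2.1 ∧ s.2.1 = s.2.2) =
        Finset.univ.image fun i : Fin n => ((i, i, i) : Idx n) := by
      rw [← filter_const_eq_image]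
      ext s
      simp only [monoIdx, Finset.mem_filter, Finset.mem_univ, true_and, and_iff_right_iff_imp]
      rintro ⟨h1, h2⟩
      exact ⟨by rw [h1], by rw [← h2, h1]⟩
    rw [e, Finset.sum_image fun i _ j _ h => (Prod.mk.inj h).1]
    rfl

/-- **MP Def. 6: the starting point sums to `M_n`** ("`S` = the decomposition of `M_n − Σ_{t∈T} t`
into standard basis elements"). [cite: MoosbauerPoole2025, Def. 6] -/
theorem sum_startElts (col : Fin n → β) : (startElts K col).sum = matMulTensor K n n n := by
  rw [startElts, Multiset.sum_add, Multiset.sum_add, ← Finset.sum_eq_multiset_sum,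
    ← Finset.sum_eq_multiset_sum, ← Finset.sum_eq_multiset_sum, sum_cube, sum_monoIdx,
    matMulTensor_eq_sum_E, sum_E_split, Finset.sum_neg_distrib]
  abel

/-! ## §3 Values, non-vanishing, rank-one -/

/-- The value of `e_{kk}⊗e_{ii}⊗e_{jj}` at its own position is `1`. [cite: MoosbauerPoole2025, Lemma 7] -/
theorem corr_apply_self (s : Idx n) :
    corr K s (s.1, s.1) (s.2.1, s.2.1) (s.2.2, s.2.2) = 1 := by
  simp [corr, unit, triad_apply]

/-- The correction products are pairwise distinct (indeed determined by their index).
[cite: MoosbauerPoole2025, Lemma 7 (proof)] -/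
theorem corr_injective : Function.Injective (corr K (n := n)) := by
  intro s s' h
  have e := congrFun (congrFun (congrFun h (s'.1, s'.1)) (s'.2.1, s'.2.1)) (s'.2.2, s'.2.2)
  rw [corr_apply_self] at e
  simp only [corr, unit, triad_apply, Pi.single_apply, Prod.mk.injEq, and_self, mul_ite, mul_one,
    mul_zero] at e
  by_cases h1 : s'.1 = s.1
  · by_cases h2 : s'.2.1 = s.2.1
    · by_cases h3 : s'.2.2 = s.2.2
      · exact (Prod.ext h1 (Prod.ext h2 h3)).symm
      · simp [h3] at e
    · simp [h2] at e
  · simp [h1] at e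

/-- The correction products are non-zero. [cite: MoosbauerPoole2025, Def. 6 with KM Def. 1] -/
theorem corr_ne_zero (s : Idx n) : corr K s ≠ 0 := fun h => by
  have e := congrFun (congrFun (congrFun h (s.1, s.1)) (s.2.1, s.2.1)) (s.2.2, s.2.2)
  rw [corr_apply_self] at e
  exact one_ne_zero e

omit [Fintype β] in
/-- The cube of a non-empty block is non-zero (value `1` at `(ii, ii, ii)`, `i ∈ P_b`).
[cite: MoosbauerPoole2025, Def. 6 with KM Def. 1] -/
theorem cube_ne_zero {col : Fin n → β} {b : β} {i : Fin n} (hi : col i = b) : cube K col b ≠ 0 := by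
  intro h
  have e := congrFun (congrFun (congrFun h (i, i)) (i, i)) (i, i)
  simp [cube, blockDiag, triad_apply, hi] at e

/-- `−(a⊗b⊗c) = (−a)⊗b⊗c`. [folklore] -/
private theorem neg_triad (a b c : Fin n × Fin n → K) : -triad a b c = triad (-a) b c := by
  funext x y z
  simp only [Pi.neg_apply, triad_apply]
  ring

/-- **The starting point `S ∪ T` of the diagonal partition `col` as a scheme of `⟨n,n,n⟩`**
(KM Def. 1: non-zero rank-one tensors summing to `⟨n,n,n⟩`; blocks non-empty).
[cite: MoosbauerPoole2025, Def. 6] -/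
def start (K : Type*) [Field K] {n : ℕ} {β : Type*} [Fintype β] [DecidableEq β]
    (col : Fin n → β) (hcol : Function.Surjective col) : Scheme (matMulTensor K n n n) where
  elts := startElts K col
  ne_zero T hT := by
    rcases Multiset.mem_add.mp hT with hT | hT
    · rcases Multiset.mem_add.mp hT with hT | hT
      · obtain ⟨s, -, rfl⟩ := Multiset.mem_map.mp hT
        exact E_ne_zero s
      · obtain ⟨s, -, rfl⟩ := Multiset.mem_map.mp hT
        exact neg_ne_zero.2 (corr_ne_zero s)
    · obtain ⟨b, -, rfl⟩ := Multiset.mem_map.mp hT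
      obtain ⟨i, hi⟩ := hcol b
      exact cube_ne_zero hi
  exists_triad T hT := by
    rcases Multiset.mem_add.mp hT with hT | hT
    · rcases Multiset.mem_add.mp hT with hT | hT
      · obtain ⟨s, -, rfl⟩ := Multiset.mem_map.mp hT
        exact ⟨_, _, _, rfl⟩
      · obtain ⟨s, -, rfl⟩ := Multiset.mem_map.mp hT
        exact ⟨_, _, _, neg_triad _ _ _⟩
    · obtain ⟨b, -, rfl⟩ := Multiset.mem_map.mp hT
      exact ⟨_, _, _, rfl⟩
  sum_eq := sum_startElts col

/-- Its elements. [cite: MoosbauerPoole2025, Def. 6] -/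
theorem start_elts (col : Fin n → β) (hcol : Function.Surjective col) :
    (start K col hcol).elts = startElts K col := rfl

/-- Its rank: `|S| + |T|` = (non-constant triples) + (correction terms) + (blocks).
[cite: MoosbauerPoole2025, Def. 6 (with §4: "schemes of rank `k·|G| + |𝒫|`")] -/
theorem rank_start (col : Fin n → β) (hcol : Function.Surjective col) :
    (start K col hcol).rank = (ndIdx n).card + (corrIdx col).card + Fintype.card β := by
  rw [Scheme.rank, start_elts, startElts, Multiset.card_add, Multiset.card_add, Multiset.card_map,
    Multiset.card_map, Multiset.card_map, Finset.card_val, Finset.card_val, Finset.card_val,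
    Finset.card_univ]

/-- There are `n³ − n` non-constant triples. [cite: MoosbauerPoole2025, §4] -/
theorem card_ndIdx : (ndIdx n).card = n ^ 3 - n := by
  have h := Finset.card_filter_add_card_filter_not
    (s := (Finset.univ : Finset (Idx n))) (fun s : Idx n => s.1 = s.2.1 ∧ s.2.1 = s.2.2)
  rw [filter_const_eq_image, Finset.card_image_of_injective _ fun i j h => (Prod.mk.inj h).1,
    Finset.card_univ, Finset.card_univ, Fintype.card_fin] at h
  simp only [Fintype.card_prod, Fintype.card_fin] at h
  rw [ndIdx]
  have : n ^ 3 = n * (n * n) := by ring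
  omega

omit [Fintype β] in
/-- The monochromatic triples number `Σ_b |P_b|³`. [cite: MoosbauerPoole2025, §4] -/
theorem card_monoIdx (col : Fin n → β) [Fintype β] :
    (monoIdx col).card = ∑ b, (block col b).card ^ 3 := by
  rw [Finset.card_eq_sum_card_fiberwise (f := fun s : Idx n => col s.1) (t := Finset.univ)
    fun _ _ => Finset.mem_univ _]
  refine Finset.sum_congr rfl fun b _ => ?_
  rw [monoIdx_filter, Finset.card_product, Finset.card_product]
  ring

omit [Fintype β] in
/-- The correction terms number `Σ_b |P_b|³ − n`. [cite: MoosbauerPoole2025, §4] -/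
theorem card_corrIdx (col : Fin n → β) [Fintype β] :
    (corrIdx col).card = ∑ b, (block col b).card ^ 3 - n := by
  have h := Finset.card_filter_add_card_filter_not
    (s := monoIdx col) (fun s : Idx n => s.1 = s.2.1 ∧ s.2.1 = s.2.2)
  have e : (monoIdx col).filter (fun s : Idx n => s.1 = s.2.1 ∧ s.2.1 = s.2.2) =
      Finset.univ.image fun i : Fin n => ((i, i, i) : Idx n) := by
    rw [← filter_const_eq_image]
    ext s
    simp only [monoIdx, Finset.mem_filter, Finset.mem_univ, true_and, and_iff_right_iff_imp]
    rintro ⟨h1, h2⟩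
    exact ⟨by rw [h1], by rw [← h2, h1]⟩
  rw [e, Finset.card_image_of_injective _ fun i j h => (Prod.mk.inj h).1, Finset.card_univ,
    Fintype.card_fin, card_monoIdx] at h
  have hc : corrIdx col = (monoIdx col).filter
      (fun s : Idx n => ¬ (s.1 = s.2.1 ∧ s.2.1 = s.2.2)) := by
    rw [corrIdx, monoIdx, Finset.filter_filter]
  rw [hc]
  omega

/-- **The rank of the starting point in closed form:** `(n³ − n) + (Σ_b |P_b|³ − n) + |𝒫|`
(MP §4: "schemes of rank `k·|G| + |𝒫|`", here `3k = n³ + Σ_b |P_b|³ − 2n`).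
[cite: MoosbauerPoole2025, Def. 6 with §4] -/
theorem rank_start_eq (col : Fin n → β) (hcol : Function.Surjective col) :
    (start K col hcol).rank = (n ^ 3 - n) + (∑ b, (block col b).card ^ 3 - n) + Fintype.card β := by
  rw [rank_start, card_ndIdx, card_corrIdx]

/-! ## §4 MP Lemma 7: `C₃`-invariance and orbits of size `3` -/

/-- Diagonal matrix units are symmetric. [folklore] -/
private theorem unit_diag_swap (a : Fin n) (p : Fin n × Fin n) :
    unit K (a, a) p.swap = unit K (a, a) p := by
  obtain ⟨p1, p2⟩ := p
  simp only [unit, Prod.swap_prod_mk, Pi.single_apply, Prod.mk.injEq]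
  by_cases h1 : p1 = a <;> by_cases h2 : p2 = a <;> simp [h1, h2]

/-- The inverse index rotation. [folklore] -/
private theorem idxCyc_symm_apply (s : Idx n) :
    (idxCyc (n := n)).symm s = (s.2.2, s.1, s.2.1) := rfl

/-- The cyclic shift rotates the correction products: `ρ(e_{kk}⊗e_{ii}⊗e_{jj}) = e_{ii}⊗e_{jj}⊗e_{kk}`.
[cite: MoosbauerPoole2025, Lemma 7 (proof)] -/
theorem cycleMap_corr (s : Idx n) : cycleMap n (corr K s) = corr K (idxCyc s) := by
  rw [corr, cycleMap_triad]
  simp only [unit_diag_swap]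
  rfl

/-- The cyclic shift rotates the standard products: `ρ(E_{κμν}) = E_{μνκ}`.
[cite: MoosbauerPoole2025, Lemma 7 (proof: "`g·a_{ij}⊗b_{jk}⊗c_{ki} = a_{jk}⊗b_{ki}⊗c_{ij}`")] -/
theorem cycleMap_E (s : Idx n) : cycleMap n (E K n s) = E K n (idxCyc s) :=
  cycleSq_E s

omit [Fintype β] in
/-- The block diagonals are symmetric matrices. [folklore] -/
private theorem blockDiag_swap (col : Fin n → β) (b : β) (q : Fin n × Fin n) :
    blockDiag K col b q.swap = blockDiag K col b q := by
  obtain ⟨q1, q2⟩ := q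
  simp only [blockDiag, Prod.swap_prod_mk]
  by_cases h : q1 = q2
  · subst h; rfl
  · rw [if_neg (fun hh => h hh.1.symm), if_neg (fun hh => h hh.1)]

omit [Fintype β] in
/-- The cyclic shift fixes the cubes ("`T` is `G`-invariant by construction").
[cite: MoosbauerPoole2025, Lemma 7 (proof)] -/
theorem cycleMap_cube (col : Fin n → β) (b : β) : cycleMap n (cube K col b) = cube K col b := by
  rw [cube, cycleMap_triad]
  congr 1 <;> funext q <;> exact blockDiag_swap col b q

/-- The index rotation preserves "not constant". [folklore] -/
private theorem ndIdx_map : (ndIdx n).map (idxCyc (n := n)).toEmbedding = ndIdx n := by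
  ext s
  simp only [Finset.mem_map_equiv, ndIdx, Finset.mem_filter, Finset.mem_univ, true_and,
    idxCyc_symm_apply]
  exact not_congr ⟨fun ⟨h1, h2⟩ => ⟨h2, (h1.trans h2).symm⟩, fun ⟨h1, h2⟩ => ⟨(h1.trans h2).symm, h1⟩⟩

omit [Fintype β] in
/-- The index rotation preserves "monochromatic and not constant". [folklore] -/
private theorem corrIdx_map (col : Fin n → β) :
    (corrIdx col).map (idxCyc (n := n)).toEmbedding = corrIdx col := by
  ext s
  simp only [Finset.mem_map_equiv, corrIdx, Finset.mem_filter, Finset.mem_univ, true_and,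
    idxCyc_symm_apply]
  exact and_congr ⟨fun ⟨h1, h2⟩ => ⟨h2.trans h1.symm, h1.symm⟩, fun ⟨h1, h2⟩ => ⟨h2.symm, h1.trans h2.symm⟩⟩
    (not_congr ⟨fun ⟨h1, h2⟩ => ⟨h2, (h1.trans h2).symm⟩, fun ⟨h1, h2⟩ => ⟨(h1.trans h2).symm, h1⟩⟩)

/-- Two `Scheme`s with the same elements are equal (bookkeeping). [folklore] -/
private theorem scheme_ext₄ {t : (Fin n × Fin n) → (Fin n × Fin n) → (Fin n × Fin n) → K}
    {x y : Scheme t} (h : x.elts = y.elts) : x = y := by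
  cases x; cases y; cases h; rfl

/-- **The cyclic shift maps the starting point to itself.** [cite: MoosbauerPoole2025, Lemma 7
("`S ∪ T` is a `G`-invariant matrix multiplication scheme")] -/
theorem start_map_cycleSq (col : Fin n → β) (hcol : Function.Surjective col) :
    (start K col hcol).map (Symmetry.cycleSq n) = start K col hcol := by
  apply scheme_ext₄
  rw [Scheme.map_elts]
  show Multiset.map (cycleMap n) (startElts K col) = startElts K col
  simp only [startElts, Multiset.map_add, Multiset.map_map]
  congr 1
  · congr 1
    · have h : cycleMap n ∘ E K n = E K n ∘ idxCyc := funext fun s => cycleMap_E s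
      rw [h, ← Multiset.map_map, ← Equiv.coe_toEmbedding, ← Finset.map_val, ndIdx_map]
    · have h : (cycleMap n ∘ fun s => -corr K s) = (fun s => -corr K s) ∘ idxCyc := by
        funext s
        show cycleMap n (-corr K s) = -corr K (idxCyc s)
        rw [← cycleMap_corr]
        rfl
      rw [h, ← Multiset.map_map, ← Equiv.coe_toEmbedding, ← Finset.map_val, corrIdx_map]
  · have h : cycleMap n ∘ cube K col = cube K col := funext fun b => cycleMap_cube col b
    rw [h]

/-- **MP Lemma 7 (i), `G = C₃`, every `n`, every diagonal partition, every field:** the starting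
point `S ∪ T` is a `C₃`-invariant matrix multiplication scheme. [cite: MoosbauerPoole2025, Lemma 7] -/
theorem start_invariant (col : Fin n → β) (hcol : Function.Surjective col) :
    IsInvariantUnder (Set.range (cycRep (K := K) n)) (start K col hcol) :=
  (isInvariantUnder_cyc_iff _).mpr (start_map_cycleSq col hcol)

/-- The cyclic shift moves every standard product with non-constant index.
[cite: MoosbauerPoole2025, Lemma 7 (proof: "implies `i = j = k`")] -/
theorem cycleMap_E_ne {s : Idx n} (hs : ¬ (s.1 = s.2.1 ∧ s.2.1 = s.2.2)) :
    cycleMap n (E K n s) ≠ E K n s := by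
  rw [cycleMap_E]
  intro h
  have e := E_injective h
  rw [idxCyc_apply] at e
  exact hs ⟨(congrArg Prod.fst e).symm, (congrArg (fun t : Idx n => t.2.1) e).symm⟩

/-- The cyclic shift moves every correction term with non-constant index.
[cite: MoosbauerPoole2025, Lemma 7 (proof: "as does `g·a_{ii}⊗b_{jj}⊗c_{kk} = a_{ii}⊗b_{jj}⊗c_{kk}`")] -/
theorem cycleMap_corr_ne {s : Idx n} (hs : ¬ (s.1 = s.2.1 ∧ s.2.1 = s.2.2)) :
    cycleMap n (-corr K s) ≠ -corr K s := by
  intro h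
  have h' : cycleMap n (corr K s) = corr K s := by
    have e2 : cycleMap n (corr K s) = -cycleMap n (-corr K s) := by
      funext a b c
      simp only [cycleMap, Pi.neg_apply, neg_neg]
    rw [e2, h, neg_neg]
  rw [cycleMap_corr] at h'
  have e := corr_injective h'
  rw [idxCyc_apply] at e
  exact hs ⟨(congrArg Prod.fst e).symm, (congrArg (fun t : Idx n => t.2.1) e).symm⟩

section Orbits

attribute [local instance] cycAction

variable [DecidableEq K]

/-- **MP Lemma 7 (ii), `G = C₃`: "the orbit of every element in `S` has size `|G|`"** (`= 3`) —
for the standard products … [cite: MoosbauerPoole2025, Lemma 7] -/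
theorem card_orbitFinset_E {s : Idx n} (hs : s ∈ ndIdx n) :
    (orbitFinset (Multiplicative (ZMod 3)) (E K n s)).card = 3 :=
  (card_orbitFinset_cyc_eq_three_iff _).mpr (cycleMap_E_ne (Finset.mem_filter.1 hs).2)

omit [Fintype β] in
/-- … and for the correction terms. [cite: MoosbauerPoole2025, Lemma 7] -/
theorem card_orbitFinset_corr {col : Fin n → β} {s : Idx n} (hs : s ∈ corrIdx col) :
    (orbitFinset (Multiplicative (ZMod 3)) (-corr K s)).card = 3 :=
  (card_orbitFinset_cyc_eq_three_iff _).mpr (cycleMap_corr_ne (Finset.mem_filter.1 hs).2.2)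

omit [Fintype β] in
/-- … while the cubes of `T` are `C₃`-invariant: their orbits are singletons.
[cite: MoosbauerPoole2025, Lemma 7 (proof: "`T` is `G`-invariant by construction")] -/
theorem card_orbitFinset_cube (col : Fin n → β) (b : β) :
    (orbitFinset (Multiplicative (ZMod 3)) (cube K col b)).card = 1 := by
  rcases card_orbitFinset_cyc (K := K) (cube K col b) with h | h
  · exact h
  · exact absurd ((card_orbitFinset_cyc_eq_three_iff _).mp h) (not_not.mpr (cycleMap_cube col b))

/-- **MP Lemma 7 for `G = C₃` in one statement:** the starting point of any diagonal partition of
`{1,…,n}` is a `C₃`-invariant scheme of `⟨n,n,n⟩` all of whose `S`-elements have orbits of size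
`|C₃| = 3`. [cite: MoosbauerPoole2025, Lemma 7] -/
theorem moosbauerPoole2025_lemma7_C3 (col : Fin n → β) (hcol : Function.Surjective col) :
    IsInvariantUnder (Set.range (cycRep (K := K) n)) (start K col hcol) ∧
    (∀ s ∈ ndIdx n, (orbitFinset (Multiplicative (ZMod 3)) (E K n s)).card = 3) ∧
    (∀ s ∈ corrIdx col, (orbitFinset (Multiplicative (ZMod 3)) (-corr K s)).card = 3) :=
  ⟨start_invariant col hcol, fun _ hs => card_orbitFinset_E hs, fun _ hs => card_orbitFinset_corr hs⟩

end Orbits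

/-! ## §5 MP Lemma 7 for `G = C₃ × ℤ₂`

MP Def. 6 / Lemma 7 with `G = C₃ × ℤ₂`: the partition must satisfy "`{n+1−i | i ∈ P} ∈ 𝒫` for every
`P ∈ 𝒫`", and the generator is "`g · a_{ij}⊗b_{jk}⊗c_{ki} = a_{n+1−j,n+1−k} ⊗ b_{n+1−k,n+1−i} ⊗
c_{n+1−i,n+1−j}`", i.e. the cyclic shift followed by conjugating all three factors with the
reversal permutation matrix (an element of KM's group `G`; `C₃ × ℤ₂ ≅ ℤ₆` is generated by it). Here
for any involution `σ` of `Fin n` with at most one fixed point (the reversal `Fin.rev`: one fixed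
point for odd `n`, none for even `n`) and any block labelling `col` with `col ∘ σ = τ ∘ col` for a
permutation `τ` of the blocks: the starting point is invariant under `g` (hence under the group it
generates), and for every element `s` of `S` the six images `g^k s`, `0 ≤ k < 6`, are pairwise
distinct ("the orbit of every element in `S` has size `|G|`" `= 6`), while `g⁶ s = s`. -/

section Z2

/-- **MP's generator `g` of `C₃ × ℤ₂`:** the cyclic shift followed by the permutation sandwich
`(P_σ, P_σ, P_σ)` (for `σ` = reversal: `a_{ij}⊗b_{jk}⊗c_{ki} ↦ a_{σj σk}⊗b_{σk σi}⊗c_{σi σj}`).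
[cite: MoosbauerPoole2025, Lemma 7 (proof, case `G = C₃ × ℤ₂`)] -/
noncomputable def gSym (σ : Equiv.Perm (Fin n)) : Symmetry (matMulTensor K n n n) :=
  (Symmetry.cycleSq n).trans (relabelSym σ σ σ)

/-- `g` lies in KM's symmetry group `G`. [cite: KauersMoosbauer2022FlipGraphs, §2 (symmetry group)] -/
theorem inSymmetryGroup_gSym (σ : Equiv.Perm (Fin n)) : InSymmetryGroup (gSym (K := K) σ) :=
  InSymmetryGroup.cycle.trans (inSymmetryGroup_relabelSym σ σ σ)

/-- The index map of `g` on the standard products: `(κ,μ,ν) ↦ (σ⁻¹μ, σ⁻¹ν, σ⁻¹κ)`.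
[cite: MoosbauerPoole2025, Lemma 7 (proof)] -/
def idxG (σ : Equiv.Perm (Fin n)) : Idx n ≃ Idx n := idxCyc.trans (idxRelabel σ σ σ)

/-- Its value. [cite: MoosbauerPoole2025, Lemma 7 (proof)] -/
@[simp] theorem idxG_apply (σ : Equiv.Perm (Fin n)) (s : Idx n) :
    idxG σ s = (σ.symm s.2.1, σ.symm s.2.2, σ.symm s.1) := rfl

/-- **`g · E_{κμν} = E_{σ⁻¹μ, σ⁻¹ν, σ⁻¹κ}`** (MP: `g·a_{ij}⊗b_{jk}⊗c_{ki} = a_{n+1−j,n+1−k}⊗…`).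
[cite: MoosbauerPoole2025, Lemma 7 (proof)] -/
theorem gSym_E (σ : Equiv.Perm (Fin n)) (s : Idx n) :
    (gSym (K := K) σ).toLinearEquiv (E K n s) = E K n (idxG σ s) := by
  show (relabelSym σ σ σ).toLinearEquiv ((Symmetry.cycleSq n).toLinearEquiv (E K n s)) = _
  rw [cycleSq_E, relabelSym_E]
  rfl

/-- Relabelled diagonal units. [folklore] -/
private theorem unit_diag_perm (σ : Equiv.Perm (Fin n)) (a : Fin n) (x : Fin n × Fin n) :
    unit K (a, a) (σ x.1, σ x.2) = unit K (σ.symm a, σ.symm a) x := by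
  obtain ⟨x1, x2⟩ := x
  simp only [unit, Pi.single_apply, Prod.mk.injEq, Equiv.apply_eq_iff_eq_symm_apply]

/-- `g` rotates-and-relabels the correction products alike. [cite: MoosbauerPoole2025, Lemma 7 (proof)] -/
theorem gSym_corr (σ : Equiv.Perm (Fin n)) (s : Idx n) :
    (gSym (K := K) σ).toLinearEquiv (corr K s) = corr K (idxG σ s) := by
  show (relabelSym σ σ σ).toLinearEquiv (cycleMap n (corr K s)) = _
  rw [cycleMap_corr, corr, relabelSym_triad]
  simp only [unit_diag_perm]
  rfl

omit [Fintype β] in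
/-- Relabelled block diagonals, for a block labelling compatible with `σ` (`col ∘ σ = τ ∘ col`).
[cite: MoosbauerPoole2025, Def. 6 (the condition on `𝒫` for `G = C₃ × ℤ₂`)] -/
theorem blockDiag_perm {col : Fin n → β} (σ : Equiv.Perm (Fin n)) (τ : β ≃ β)
    (hτ : ∀ i, col (σ i) = τ (col i)) (b : β) (x : Fin n × Fin n) :
    blockDiag K col b (σ x.1, σ x.2) = blockDiag K col (τ.symm b) x := by
  obtain ⟨x1, x2⟩ := x
  simp only [blockDiag, hτ, Equiv.symm_apply_apply, Equiv.apply_eq_iff_eq_symm_apply]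

omit [Fintype β] in
/-- **`g` permutes the cubes:** `g · T_b = T_{τ⁻¹ b}`. [cite: MoosbauerPoole2025, Lemma 7 (proof:
"`T` is `G`-invariant by construction")] -/
theorem gSym_cube {col : Fin n → β} (σ : Equiv.Perm (Fin n)) (τ : β ≃ β)
    (hτ : ∀ i, col (σ i) = τ (col i)) (b : β) :
    (gSym (K := K) σ).toLinearEquiv (cube K col b) = cube K col (τ.symm b) := by
  show (relabelSym σ σ σ).toLinearEquiv (cycleMap n (cube K col b)) = _
  rw [cycleMap_cube, cube, relabelSym_triad]
  simp only [blockDiag_perm σ τ hτ]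
  rfl

/-- The inverse index map. [folklore] -/
private theorem idxG_symm_apply (σ : Equiv.Perm (Fin n)) (s : Idx n) :
    (idxG σ).symm s = (σ s.2.2, σ s.1, σ s.2.1) := rfl

/-- `g`'s index map preserves "not constant". [folklore] -/
private theorem ndIdx_mapG (σ : Equiv.Perm (Fin n)) :
    (ndIdx n).map (idxG σ).toEmbedding = ndIdx n := by
  ext s
  simp only [Finset.mem_map_equiv, ndIdx, Finset.mem_filter, Finset.mem_univ, true_and,
    idxG_symm_apply, Equiv.apply_eq_iff_eq]
  exact not_congr ⟨fun ⟨h1, h2⟩ => ⟨h2, (h1.trans h2).symm⟩, fun ⟨h1, h2⟩ => ⟨(h1.trans h2).symm, h1⟩⟩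

omit [Fintype β] in
/-- `g`'s index map preserves "monochromatic and not constant" (compatible labelling). [folklore] -/
private theorem corrIdx_mapG {col : Fin n → β} (σ : Equiv.Perm (Fin n)) (τ : β ≃ β)
    (hτ : ∀ i, col (σ i) = τ (col i)) :
    (corrIdx col).map (idxG σ).toEmbedding = corrIdx col := by
  ext s
  simp only [Finset.mem_map_equiv, corrIdx, Finset.mem_filter, Finset.mem_univ, true_and,
    idxG_symm_apply, hτ, Equiv.apply_eq_iff_eq]
  exact and_congr ⟨fun ⟨h1, h2⟩ => ⟨h2.trans h1.symm, h1.symm⟩, fun ⟨h1, h2⟩ => ⟨h2.symm, h1.trans h2.symm⟩⟩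
    (not_congr ⟨fun ⟨h1, h2⟩ => ⟨h2, (h1.trans h2).symm⟩, fun ⟨h1, h2⟩ => ⟨(h1.trans h2).symm, h1⟩⟩)

/-- **`g` maps the starting point of a `σ`-compatible diagonal partition to itself.**
[cite: MoosbauerPoole2025, Lemma 7 (`G = C₃ × ℤ₂`: "`S ∪ T` is a `G`-invariant matrix
multiplication scheme")] -/
theorem start_map_gSym {col : Fin n → β} (hcol : Function.Surjective col) (σ : Equiv.Perm (Fin n))
    (τ : β ≃ β) (hτ : ∀ i, col (σ i) = τ (col i)) :
    (start K col hcol).map (gSym σ) = start K col hcol := by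
  apply scheme_ext₄
  rw [Scheme.map_elts, start_elts, startElts, Multiset.map_add, Multiset.map_add, Multiset.map_map,
    Multiset.map_map, Multiset.map_map]
  congr 1
  · congr 1
    · have h : (gSym (K := K) σ).toLinearEquiv ∘ E K n = E K n ∘ idxG σ := funext (gSym_E σ)
      rw [h, ← Multiset.map_map, ← Equiv.coe_toEmbedding, ← Finset.map_val, ndIdx_mapG]
    · have h : ((gSym (K := K) σ).toLinearEquiv ∘ fun s => -corr K s) =
          (fun s => -corr K s) ∘ idxG σ := by
        funext s
        show (gSym σ).toLinearEquiv (-corr K s) = -corr K (idxG σ s)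
        rw [map_neg, gSym_corr]
      rw [h, ← Multiset.map_map, ← Equiv.coe_toEmbedding, ← Finset.map_val, corrIdx_mapG σ τ hτ]
  · have h : (gSym (K := K) σ).toLinearEquiv ∘ cube K col = cube K col ∘ τ.symm :=
      funext (gSym_cube σ τ hτ)
    rw [h, ← Multiset.map_map, Multiset.map_univ_val_equiv]

/-- … hence it is invariant under the group generated by `g` (all powers `g^k`).
[cite: MoosbauerPoole2025, Lemma 7 (`G = C₃ × ℤ₂`)] -/
theorem start_invariant_gSym {col : Fin n → β} (hcol : Function.Surjective col)
    (σ : Equiv.Perm (Fin n)) (τ : β ≃ β) (hτ : ∀ i, col (σ i) = τ (col i)) :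
    IsInvariantUnder (Set.range fun k : ℕ => (gSym (K := K) σ).pow k) (start K col hcol) := by
  rintro φ ⟨k, rfl⟩
  induction k with
  | zero => exact Scheme.map_refl _
  | succ k ih =>
    show (start K col hcol).map (((gSym σ).pow k).trans (gSym σ)) = _
    rw [Scheme.map_trans, ih, start_map_gSym hcol σ τ hτ]

/-- Powers of `g` on the standard products. [cite: MoosbauerPoole2025, Lemma 7 (proof)] -/
theorem gSym_pow_E (σ : Equiv.Perm (Fin n)) (k : ℕ) (s : Idx n) :
    ((gSym (K := K) σ).pow k).toLinearEquiv (E K n s) = E K n ((idxG σ)^[k] s) := by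
  rw [Symmetry.pow_apply]
  induction k generalizing s with
  | zero => rfl
  | succ k ih => rw [Function.iterate_succ_apply, Function.iterate_succ_apply, gSym_E, ih]

/-- Powers of `g` on the correction terms. [cite: MoosbauerPoole2025, Lemma 7 (proof)] -/
theorem gSym_pow_corr (σ : Equiv.Perm (Fin n)) (k : ℕ) (s : Idx n) :
    ((gSym (K := K) σ).pow k).toLinearEquiv (-corr K s) = -corr K ((idxG σ)^[k] s) := by
  rw [Symmetry.pow_apply]
  induction k generalizing s with
  | zero => rfl
  | succ k ih =>
    rw [Function.iterate_succ_apply, Function.iterate_succ_apply, map_neg, gSym_corr, ih]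

/-- For an involution `σ`: `σ⁻¹ = σ`. [folklore] -/
private theorem symm_eq_of_invol {σ : Equiv.Perm (Fin n)} (hσ : ∀ i, σ (σ i) = i) : σ.symm = σ :=
  Equiv.ext fun i => σ.injective (by rw [Equiv.apply_symm_apply, hσ])

/-- **The six iterates of `g`'s index map move every non-constant triple** (for an involution `σ`
with at most one fixed point; MP: "`g·a_{ij}⊗b_{jk}⊗c_{ki} = a_{ij}⊗b_{jk}⊗c_{ki}` implies … `i = j = k`",
likewise for `g², …, g⁵`), and `g⁶` fixes everything. [cite: MoosbauerPoole2025, Lemma 7 (proof)] -/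
theorem idxG_iterate {σ : Equiv.Perm (Fin n)} (hσ : ∀ i, σ (σ i) = i)
    (hσ1 : ∀ i j, σ i = i → σ j = j → i = j) (s : Idx n) :
    ((idxG σ)^[6] s = s) ∧
    (¬ (s.1 = s.2.1 ∧ s.2.1 = s.2.2) → ∀ d, 0 < d → d < 6 → (idxG σ)^[d] s ≠ s) := by
  have hs : σ.symm = σ := symm_eq_of_invol hσ
  obtain ⟨a, b, c⟩ := s
  have e1 : (idxG σ)^[1] (a, b, c) = (σ b, σ c, σ a) := by
    simp only [Function.iterate_one, idxG_apply, hs]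
  have e2 : (idxG σ)^[2] (a, b, c) = (c, a, b) := by
    simp only [Function.iterate_succ, Function.iterate_zero, Function.comp_apply, id_eq, idxG_apply,
      hs, hσ]
  have e3 : (idxG σ)^[3] (a, b, c) = (σ a, σ b, σ c) := by
    simp only [Function.iterate_succ, Function.iterate_zero, Function.comp_apply, id_eq, idxG_apply,
      hs, hσ]
  have e4 : (idxG σ)^[4] (a, b, c) = (b, c, a) := by
    simp only [Function.iterate_succ, Function.iterate_zero, Function.comp_apply, id_eq, idxG_apply,
      hs, hσ]
  have e5 : (idxG σ)^[5] (a, b, c) = (σ c, σ a, σ b) := by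
    simp only [Function.iterate_succ, Function.iterate_zero, Function.comp_apply, id_eq, idxG_apply,
      hs, hσ]
  have e6 : (idxG σ)^[6] (a, b, c) = (a, b, c) := by
    simp only [Function.iterate_succ, Function.iterate_zero, Function.comp_apply, id_eq, idxG_apply,
      hs, hσ]
  refine ⟨e6, fun hne d hd0 hd6 => ?_⟩
  simp only at hne
  interval_cases d
  · rw [e1]
    intro h
    obtain ⟨h1, h23⟩ := Prod.mk.inj h
    obtain ⟨h2, h3⟩ := Prod.mk.inj h23
    -- `σ b = a`, `σ c = b`, `σ a = c`
    have hb : b = a := by rw [← h2, ← h3, hσ]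
    rw [hb] at h1
    exact hne ⟨hb.symm, hb.trans (h1.symm.trans h3)⟩
  · rw [e2]
    intro h
    obtain ⟨-, h23⟩ := Prod.mk.inj h
    obtain ⟨h2, h3⟩ := Prod.mk.inj h23
    exact hne ⟨h2, h3⟩
  · rw [e3]
    intro h
    obtain ⟨h1, h23⟩ := Prod.mk.inj h
    obtain ⟨h2, h3⟩ := Prod.mk.inj h23
    exact hne ⟨hσ1 a b h1 h2, hσ1 b c h2 h3⟩
  · rw [e4]
    intro h
    obtain ⟨h1, h23⟩ := Prod.mk.inj h
    obtain ⟨h2, -⟩ := Prod.mk.inj h23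
    exact hne ⟨h1.symm, h2.symm⟩
  · rw [e5]
    intro h
    obtain ⟨h1, h23⟩ := Prod.mk.inj h
    obtain ⟨h2, h3⟩ := Prod.mk.inj h23
    -- `σ c = a`, `σ a = b`, `σ b = c`
    have hbc : b = c := by rw [← h2, ← h1, hσ]
    rw [hbc] at h3
    exact hne ⟨(h1.symm.trans h3).trans hbc.symm, hbc⟩

/-- From "no iterate `0 < d < 6` fixes `s`" to "the six iterates are pairwise distinct". [folklore] -/
private theorem injective_iterate_of_ne {f : Idx n ≃ Idx n} {s : Idx n}
    (h : ∀ d, 0 < d → d < 6 → f^[d] s ≠ s) :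
    Function.Injective fun k : Fin 6 => f^[k] s := by
  intro a b hab
  simp only at hab
  by_contra hne
  have hne' : (a : ℕ) ≠ b := fun hv => hne (Fin.ext hv)
  rcases le_total (a : ℕ) b with hle | hle
  · have e : f^[a] (f^[(b : ℕ) - a] s) = f^[a] s := by
      rw [← Function.iterate_add_apply, Nat.add_sub_cancel' hle]; exact hab.symm
    exact h _ (by omega) (by omega) ((f.injective.iterate a) e)
  · have e : f^[b] (f^[(a : ℕ) - b] s) = f^[b] s := by
      rw [← Function.iterate_add_apply, Nat.add_sub_cancel' hle]; exact hab
    exact h _ (by omega) (by omega) ((f.injective.iterate b) e)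

/-- **MP Lemma 7 (ii) for `G = C₃ × ℤ₂`, standard products:** the six images `g^k E_s`, `0 ≤ k < 6`,
of a standard product with non-constant index are pairwise distinct ("orbit of size `|G|`").
[cite: MoosbauerPoole2025, Lemma 7] -/
theorem injective_pow_E {σ : Equiv.Perm (Fin n)} (hσ : ∀ i, σ (σ i) = i)
    (hσ1 : ∀ i j, σ i = i → σ j = j → i = j) {s : Idx n} (hs : s ∈ ndIdx n) :
    Function.Injective fun k : Fin 6 => ((gSym (K := K) σ).pow k).toLinearEquiv (E K n s) := by
  intro a b hab
  simp only [gSym_pow_E] at hab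
  exact injective_iterate_of_ne ((idxG_iterate hσ hσ1 s).2 (Finset.mem_filter.1 hs).2)
    (E_injective hab)

omit [Fintype β] in
/-- **MP Lemma 7 (ii) for `G = C₃ × ℤ₂`, correction terms.** [cite: MoosbauerPoole2025, Lemma 7] -/
theorem injective_pow_corr {col : Fin n → β} {σ : Equiv.Perm (Fin n)} (hσ : ∀ i, σ (σ i) = i)
    (hσ1 : ∀ i j, σ i = i → σ j = j → i = j) {s : Idx n} (hs : s ∈ corrIdx col) :
    Function.Injective fun k : Fin 6 => ((gSym (K := K) σ).pow k).toLinearEquiv (-corr K s) := by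
  intro a b hab
  simp only [gSym_pow_corr, neg_inj] at hab
  exact injective_iterate_of_ne ((idxG_iterate hσ hσ1 s).2 (Finset.mem_filter.1 hs).2.2)
    (corr_injective hab)

/-- `g⁶` fixes the elements of `S`. [cite: MoosbauerPoole2025, Lemma 7 (`|G| = 6`)] -/
theorem gSym_pow_six {σ : Equiv.Perm (Fin n)} (hσ : ∀ i, σ (σ i) = i)
    (hσ1 : ∀ i j, σ i = i → σ j = j → i = j) (s : Idx n) :
    ((gSym (K := K) σ).pow 6).toLinearEquiv (E K n s) = E K n s ∧
    ((gSym (K := K) σ).pow 6).toLinearEquiv (-corr K s) = -corr K s := by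
  rw [gSym_pow_E, gSym_pow_corr, (idxG_iterate hσ hσ1 s).1]
  exact ⟨rfl, rfl⟩

/-- The reversal `i ↦ n+1−i` is an involution with at most one fixed point (MP §4: for odd `n`
the middle index, for even `n` none). [cite: MoosbauerPoole2025, §4 (the `ℤ₂`-invariant standard
products)] -/
theorem rev_invol_fixed :
    (∀ i : Fin n, Fin.revPerm (Fin.revPerm i) = i) ∧
    ∀ i j : Fin n, Fin.revPerm i = i → Fin.revPerm j = j → i = j := by
  refine ⟨fun i => by simp [Fin.revPerm_apply, Fin.rev_rev], fun i j hi hj => ?_⟩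
  rw [Fin.revPerm_apply] at hi hj
  have hi' := congrArg Fin.val hi
  have hj' := congrArg Fin.val hj
  rw [Fin.val_rev] at hi' hj'
  exact Fin.ext (by omega)

/-- **MP Lemma 7 for `G = C₃ × ℤ₂` in one statement** (`g` = MP's generator with the reversal
`i ↦ n+1−i`; a diagonal partition with "`{n+1−i | i ∈ P} ∈ 𝒫` for every `P ∈ 𝒫`", the induced
permutation of the blocks being `τ`): the starting point is invariant under every power of `g`,
and every element of `S` has six pairwise distinct images `g^k s`, `0 ≤ k < 6` (orbit of size
`|C₃ × ℤ₂| = 6`). [cite: MoosbauerPoole2025, Lemma 7] -/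
theorem moosbauerPoole2025_lemma7_C3Z2 {col : Fin n → β} (hcol : Function.Surjective col)
    (τ : β ≃ β) (hτ : ∀ i, col (Fin.revPerm i) = τ (col i)) :
    IsInvariantUnder (Set.range fun k : ℕ => (gSym (K := K) Fin.revPerm).pow k) (start K col hcol) ∧
    (∀ s ∈ ndIdx n, Function.Injective
      fun k : Fin 6 => ((gSym (K := K) Fin.revPerm).pow k).toLinearEquiv (E K n s)) ∧
    (∀ s ∈ corrIdx col, Function.Injective
      fun k : Fin 6 => ((gSym (K := K) Fin.revPerm).pow k).toLinearEquiv (-corr K s)) :=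
  ⟨start_invariant_gSym hcol _ τ hτ,
    fun _ hs => injective_pow_E rev_invol_fixed.1 rev_invol_fixed.2 hs,
    fun _ hs => injective_pow_corr rev_invol_fixed.1 rev_invol_fixed.2 hs⟩

end Z2

/-! ## §6 The invariant standard products (MP §4)

MP §4: "Some of these rank-one tensors are `C₃`-invariant. This is only the case if `i = j = k`. If
`n` is odd then there is one `ℤ₂` invariant rank-one tensor in the standard algorithm, namely
`a_{mm}⊗b_{mm}⊗c_{mm}`, `m = (n+1)/2`, otherwise there are none." (`ℤ₂` = conjugation by the
reversal, the cube `g³` of MP's generator.) -/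

section InvariantProducts

/-- **"`C₃`-invariant only if `i = j = k`"** (and then indeed invariant): the cyclic shift fixes the
standard product `E_{κμν}` iff `κ = μ = ν`. [cite: MoosbauerPoole2025, §4] -/
theorem cycleMap_E_eq_iff (s : Idx n) :
    cycleMap n (E K n s) = E K n s ↔ (s.1 = s.2.1 ∧ s.2.1 = s.2.2) := by
  rw [cycleMap_E]
  constructor
  · intro h
    have e := E_injective h
    rw [idxCyc_apply] at e
    exact ⟨(congrArg Prod.fst e).symm, (congrArg (fun t : Idx n => t.2.1) e).symm⟩
  · rintro ⟨h1, h2⟩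
    obtain ⟨a, b, c⟩ := s
    simp only at h1 h2
    subst h1 h2
    rfl

/-- `g³` is the conjugation of all three factors by `P_σ` on the standard products:
`g³ · E_{κμν} = E_{σκ, σμ, σν}`. [cite: MoosbauerPoole2025, §4 (the subgroup `ℤ₂`)] -/
theorem gSym_pow_three_E {σ : Equiv.Perm (Fin n)} (hσ : ∀ i, σ (σ i) = i) (s : Idx n) :
    ((gSym (K := K) σ).pow 3).toLinearEquiv (E K n s) = E K n (σ s.1, σ s.2.1, σ s.2.2) := by
  have hs : σ.symm = σ := symm_eq_of_invol hσ
  rw [gSym_pow_E]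
  obtain ⟨a, b, c⟩ := s
  simp only [Function.iterate_succ, Function.iterate_zero, Function.comp_apply, id_eq, idxG_apply,
    hs, hσ]

/-- **The `ℤ₂`-invariant standard products:** `g³ · E_{κμν} = E_{κμν}` iff `κ, μ, ν` are fixed by
`σ`; for an involution with at most one fixed point, iff `κ = μ = ν` is that fixed point.
[cite: MoosbauerPoole2025, §4] -/
theorem gSym_pow_three_E_eq_iff {σ : Equiv.Perm (Fin n)} (hσ : ∀ i, σ (σ i) = i) (s : Idx n) :
    ((gSym (K := K) σ).pow 3).toLinearEquiv (E K n s) = E K n s ↔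
      (σ s.1 = s.1 ∧ σ s.2.1 = s.2.1 ∧ σ s.2.2 = s.2.2) := by
  rw [gSym_pow_three_E hσ]
  constructor
  · intro h
    have e := E_injective h
    exact ⟨congrArg Prod.fst e, congrArg (fun t : Idx n => t.2.1) e,
      congrArg (fun t : Idx n => t.2.2) e⟩
  · rintro ⟨h1, h2, h3⟩
    rw [h1, h2, h3]

/-- The fixed points of the reversal `i ↦ n+1−i` of `{1,…,n}` (here `Fin n`, `i ↦ n−1−i`): `i` is
fixed iff `2i + 1 = n` (MP §4: "`(n+1)/2`" for odd `n`). [cite: MoosbauerPoole2025, §4 (the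
`ℤ₂`-invariant standard products)] -/
theorem revPerm_eq_self_iff (i : Fin n) : Fin.revPerm i = i ↔ 2 * (i : ℕ) + 1 = n := by
  rw [Fin.revPerm_apply]
  constructor
  · intro h
    have h' := congrArg Fin.val h
    rw [Fin.val_rev] at h'
    omega
  · intro h
    apply Fin.ext
    rw [Fin.val_rev]
    omega

/-- **MP §4: for even `n` no standard product is `ℤ₂`-invariant.** [cite: MoosbauerPoole2025, §4] -/
theorem no_rev_invariant_E_of_even (hn : Even n) (s : Idx n) :
    ((gSym (K := K) Fin.revPerm).pow 3).toLinearEquiv (E K n s) ≠ E K n s := by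
  rw [Ne, gSym_pow_three_E_eq_iff rev_invol_fixed.1, revPerm_eq_self_iff]
  rintro ⟨h1, -, -⟩
  obtain ⟨k, hk⟩ := hn
  omega

/-- **MP §4: for odd `n` exactly the middle cube `a_{mm}⊗b_{mm}⊗c_{mm}` is `ℤ₂`-invariant**
(`m = (n+1)/2`, here the index `(n−1)/2` of `Fin n`). [cite: MoosbauerPoole2025, §4] -/
theorem rev_invariant_E_iff_of_odd {m : ℕ} (hn : n = 2 * m + 1) (s : Idx n) :
    ((gSym (K := K) Fin.revPerm).pow 3).toLinearEquiv (E K n s) = E K n s ↔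
      s = (⟨m, by omega⟩, ⟨m, by omega⟩, ⟨m, by omega⟩) := by
  rw [gSym_pow_three_E_eq_iff rev_invol_fixed.1, revPerm_eq_self_iff, revPerm_eq_self_iff,
    revPerm_eq_self_iff]
  obtain ⟨a, b, c⟩ := s
  simp only [Prod.mk.injEq, Fin.ext_iff]
  omega

end InvariantProducts

/-! ## §7 `g` has order `6` on the whole tensor space

`g = (cyclic shift) ∘ (P_σ, P_σ, P_σ)` for an involution `σ`: on rank-one tensors
`z⊗x⊗y ↦ x(σ·,σ·)ᵀ ⊗ y(σ·,σ·) ⊗ z(σ·,σ·)ᵀ`, so `g³` conjugates all factors by `P_σ` and `g⁶ = id`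
(MP: `G = C₃ × ℤ₂` has order `6` and is generated by `g`). -/

section OrderSix

/-- **`g` on rank-one tensors.** [cite: MoosbauerPoole2025, Lemma 7 (proof, the generator `g` of
`C₃ × ℤ₂`)] -/
theorem gSym_triad (σ : Equiv.Perm (Fin n)) (z x y : Fin n × Fin n → K) :
    (gSym (K := K) σ).toLinearEquiv (triad z x y) =
      triad (fun p => x (σ p.2, σ p.1)) (fun p => y (σ p.1, σ p.2)) (fun p => z (σ p.2, σ p.1)) := by
  show (relabelSym σ σ σ).toLinearEquiv ((Symmetry.cycleSq n).toLinearEquiv (triad z x y)) = _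
  rw [cycleSq_triad, relabelSym_triad]
  rfl

/-- `g²` on rank-one tensors (for an involution `σ`): `z⊗x⊗y ↦ yᵀ ⊗ zᵀ ⊗ x`.
[cite: MoosbauerPoole2025, §2 (`C₃ × ℤ₂`)] -/
theorem gSym_iterate_two_triad {σ : Equiv.Perm (Fin n)} (hσ : ∀ i, σ (σ i) = i)
    (z x y : Fin n × Fin n → K) :
    ((gSym (K := K) σ).toLinearEquiv)^[2] (triad z x y) =
      triad (fun p => y p.swap) (fun p => z p.swap) x := by
  rw [Function.iterate_succ_apply', Function.iterate_one, gSym_triad, gSym_triad]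
  simp only [hσ, Prod.mk.eta]
  rfl

/-- `g³` on rank-one tensors (for an involution `σ`): conjugation of all three factors by `P_σ`.
[cite: MoosbauerPoole2025, §2 (`C₃ × ℤ₂`: the subgroup `ℤ₂`)] -/
theorem gSym_iterate_three_triad {σ : Equiv.Perm (Fin n)} (hσ : ∀ i, σ (σ i) = i)
    (z x y : Fin n × Fin n → K) :
    ((gSym (K := K) σ).toLinearEquiv)^[3] (triad z x y) =
      triad (fun p => z (σ p.1, σ p.2)) (fun p => x (σ p.1, σ p.2)) (fun p => y (σ p.1, σ p.2)) := by
  rw [Function.iterate_succ_apply', gSym_iterate_two_triad hσ, gSym_triad]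
  rfl

/-- `g⁶` fixes every rank-one tensor (for an involution `σ`). [cite: MoosbauerPoole2025, §2
(`C₃ × ℤ₂`, a group of order `6`)] -/
theorem gSym_iterate_six_triad {σ : Equiv.Perm (Fin n)} (hσ : ∀ i, σ (σ i) = i)
    (z x y : Fin n × Fin n → K) :
    ((gSym (K := K) σ).toLinearEquiv)^[6] (triad z x y) = triad z x y := by
  rw [show 6 = 3 + 3 from rfl, Function.iterate_add_apply, gSym_iterate_three_triad hσ,
    gSym_iterate_three_triad hσ]
  simp only [hσ, Prod.mk.eta]

/-- **`g⁶ = id` on the whole tensor space** (every tensor is a sum of rank-one tensors).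
[cite: MoosbauerPoole2025, §2 (`C₃ × ℤ₂`, a group of order `6`)] -/
theorem gSym_iterate_six {σ : Equiv.Perm (Fin n)} (hσ : ∀ i, σ (σ i) = i)
    (T : (Fin n × Fin n) → (Fin n × Fin n) → (Fin n × Fin n) → K) :
    ((gSym (K := K) σ).toLinearEquiv)^[6] T = T := by
  rw [← Symmetry.pow_apply, ← (stdScheme T).sum_eq, _root_.map_multiset_sum]
  refine congrArg Multiset.sum ?_
  conv_rhs => rw [← Multiset.map_id (stdScheme T).elts]
  refine Multiset.map_congr rfl fun U hU => ?_
  obtain ⟨a, b, c, rfl⟩ := (stdScheme T).exists_triad U hU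
  rw [Symmetry.pow_apply, id_eq]
  exact gSym_iterate_six_triad hσ a b c

end OrderSix

/-! ## §8 The orbits of `S` under `C₃ × ℤ₂ = ⟨g⟩` have size `6`

With `FlipGraphCyclicGroupAction.lean`: `g⁶ = id` makes `k ↦ g^k` an action of the cyclic group of
order `6` (`≅ C₃ × ℤ₂`) on the tensor space by symmetries, and MP Lemma 7 (ii) becomes the orbit count
`|G·s| = 6 = |G|` in the vocabulary of `FlipGraphOrbitFlips.lean` (so MP Thm. 4 applies to the
starting point with this group). -/

section OrbitsZ6

/-- The starting point of a `σ`-compatible partition is invariant under the whole group `⟨g⟩`.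
[cite: MoosbauerPoole2025, Lemma 7 (`G = C₃ × ℤ₂`)] -/
theorem start_invariant_cyclicRep {col : Fin n → β} (hcol : Function.Surjective col)
    (σ : Equiv.Perm (Fin n)) (τ : β ≃ β) (hτ : ∀ i, col (σ i) = τ (col i)) (m : ℕ) :
    IsInvariantUnder (Set.range ((gSym (K := K) σ).cyclicRep m)) (start K col hcol) :=
  (gSym σ).isInvariantUnder_cyclicRep m _ (start_map_gSym hcol σ τ hτ)

variable [DecidableEq K]

/-- **MP Lemma 7 (ii), `G = C₃ × ℤ₂`, as an orbit count:** the orbit of a standard product with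
non-constant index under `⟨g⟩` (order `6`) has `6` elements. [cite: MoosbauerPoole2025, Lemma 7] -/
theorem card_orbitFinset_gSym_E {σ : Equiv.Perm (Fin n)} (hσ : ∀ i, σ (σ i) = i)
    (hσ1 : ∀ i j, σ i = i → σ j = j → i = j) {s : Idx n} (hs : s ∈ ndIdx n) :
    letI := (gSym (K := K) σ).cyclicAction 6 (gSym_iterate_six hσ)
    (orbitFinset (Multiplicative (ZMod 6)) (E K n s)).card = 6 := by
  rw [Symmetry.card_orbitFinset_cyclic_eq_iff]
  intro k hk hk6 h
  rw [← Symmetry.pow_apply, gSym_pow_E] at h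
  exact (idxG_iterate hσ hσ1 s).2 (Finset.mem_filter.1 hs).2 k hk hk6 (E_injective h)

omit [Fintype β] in
/-- … and so does the orbit of a correction term. [cite: MoosbauerPoole2025, Lemma 7] -/
theorem card_orbitFinset_gSym_corr {col : Fin n → β} {σ : Equiv.Perm (Fin n)}
    (hσ : ∀ i, σ (σ i) = i) (hσ1 : ∀ i j, σ i = i → σ j = j → i = j) {s : Idx n}
    (hs : s ∈ corrIdx col) :
    letI := (gSym (K := K) σ).cyclicAction 6 (gSym_iterate_six hσ)
    (orbitFinset (Multiplicative (ZMod 6)) (-corr K s)).card = 6 := by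
  rw [Symmetry.card_orbitFinset_cyclic_eq_iff]
  intro k hk hk6 h
  rw [← Symmetry.pow_apply, gSym_pow_corr, neg_inj] at h
  exact (idxG_iterate hσ hσ1 s).2 (Finset.mem_filter.1 hs).2.2 k hk hk6 (corr_injective h)

/-- **MP Lemma 7 for `G = C₃ × ℤ₂ = ⟨g⟩` (reversal `σ`, order `6`) in the orbit vocabulary of
`FlipGraphOrbitFlips.lean`:** the group lies in KM's `G`, the starting point of a reversal-closed
diagonal partition is invariant under it, and every element of `S` has an orbit of size `|G| = 6`.
[cite: MoosbauerPoole2025, Lemma 7] -/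
theorem moosbauerPoole2025_lemma7_C3Z2_orbits {col : Fin n → β} (hcol : Function.Surjective col)
    (τ : β ≃ β) (hτ : ∀ i, col (Fin.revPerm i) = τ (col i)) :
    letI := (gSym (K := K) (n := n) Fin.revPerm).cyclicAction 6 (gSym_iterate_six rev_invol_fixed.1)
    (∀ g, InSymmetryGroup ((gSym (K := K) (n := n) Fin.revPerm).cyclicRep 6 g)) ∧
    IsInvariantUnder (Set.range ((gSym (K := K) Fin.revPerm).cyclicRep 6)) (start K col hcol) ∧
    (∀ s ∈ ndIdx n, (orbitFinset (Multiplicative (ZMod 6)) (E K n s)).card = 6) ∧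
    (∀ s ∈ corrIdx col, (orbitFinset (Multiplicative (ZMod 6)) (-corr K s)).card = 6) :=
  ⟨fun g => (inSymmetryGroup_gSym _).cyclicRep 6 g, start_invariant_cyclicRep hcol _ τ hτ 6,
    fun _ hs => card_orbitFinset_gSym_E rev_invol_fixed.1 rev_invol_fixed.2 hs,
    fun _ hs => card_orbitFinset_gSym_corr rev_invol_fixed.1 rev_invol_fixed.2 hs⟩

end OrbitsZ6

end DiagonalStart

end Literature.Computability.AlgebraicComplexity
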